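import Literature.Analysis.ValidatedNumerics.TaylorModelLog
import HarnessLib

/-!
# Bivariate Taylor models: arithmetic, range bounds and the exponential in two variables

Trunk T-ANA (Analysis/ValidatedNumerics); namespace `Literature.Analysis.ValidatedNumerics.PolyMP`.
Sequel of `TaylorModel.lean` (univariate Taylor models `TMem S h f P` over the fixed-point intervals `MI` of scale
`S`), `TaylorModelExp.lean` and `TaylorModelLog.lean` (the intrinsic `exp ∘ g`).  The Taylor-model method of
Berz–Makino is MULTIVARIATE from the start (op. cit. Definition 1: `f(x) ∈ P(x − x₀) + I` on a box `D ⊂ ℝ^v`);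
this file is the case `v = 2` in the representation used throughout this library — a polynomial with INTERVAL
coefficients, the remainder folded into the constant coefficient — organised so that every range bound is
inherited from the univariate file:

* the real shadow `evalR2 rows ρ σ = Σᵢ ρⁱ · evalR rowsᵢ σ` (row `i` = the coefficient of `ρⁱ`, a coefficient list
  in `σ`), `addR2`, `mulR2`, `evalR2_take_add_drop`;
* `IPoly2 = List IPoly`, `PMem2` (row-wise `PMem`), and the membership predicate
  `TMem2 S h k f P`: on the box `|ρ| ≤ h, |σ| ≤ k`, `f ρ σ = evalR2 rows ρ σ` for some rows in `P`
  [op. cit. Definition 1, with interval coefficients];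
* the arithmetic `tconst2`, `tvarX2`, `tvarY2` (the identity Taylor models of op. cit. Algorithm 2 step 1),
  `tadd2`, `tneg2`, `tsub2`, `tsmulI2`, the product `mul2` and the TRUNCATED product `tmul2 S h k D`
  (rows `i ≤ D` kept, row `i` truncated to `σ`-degree `D − i`, everything else bounded on the box and folded into
  the constant coefficient: op. cit. Definition 2, "the part of `P₁·P₂` of orders `> n` is bounded into the
  remainder"), each with its inclusion theorem `tmem2_*`;
* the COLLAPSE `tcollapse S k P` — replace every row by the univariate range interval `[tlowerI, tupperI]` of that
  row on `|σ| ≤ k` — with `tmem_collapse : TMem2 S h k f P → |σ| ≤ k → TMem S h (f · σ) (tcollapse S k P)`; hence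
  the scaled range bounds `tupper2`, `tlower2`, `tabs2` and their soundness are one-liners over `TaylorModel.lean`
  (naive interval bounding of the polynomial part, op. cit. §5 "naive interval evaluation of the Taylor
  polynomial");
* the intrinsic `exp`: `thorner2` (a rational polynomial of a bivariate Taylor model, Horner), `texpComp2` /
  `tmem2_expComp` (`e^{u}` for `|u| ≤ 1` by the exponential series with Lagrange-type remainder) and
  `texp2TM S h k D K Ke ke G` with `tmem2_exp_of_texp2TM`: `e^{g} = e^{c} · e^{g − c}`, `c` the rational midpoint
  of the constant coefficient, `e^{c} ∈ MI.expPt` — op. cit. Definition 3, (2.2)–(2.4).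

The integration of bivariate Taylor models over boxes (op. cit. Algorithm 2, steps 3–4) and kernel-checkable
certificates for double integrals are in the sequel `TaylorModelIntegralCert2D.lean`.  Problem-independent; no
facts, no axioms; all data computable over `ℤ`.

## References

* K. Makino, M. Berz, *Taylor models and other validated functional inclusion methods*, Int. J. Pure Appl.
  Math. 4 (2003) 379–456: Definition 1 (multivariate Taylor model), Definition 2 (addition and multiplication,
  truncation of the orders `n+1 … 2n` into the remainder), Definition 3 with (2.2)–(2.4) (the exponential),
  Algorithm 2 (quadrature). [cite: MakinoBerz2003, Definition 1] [cite: MakinoBerz2003, Definition 2]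
  [cite: MakinoBerz2003, Definition 3]
* M. Berz, K. Makino, *New methods for high-dimensional verified quadrature*, Reliable Computing 5 (1999)
  13–22 (the same scheme applied to multidimensional integrals). [cite: BerzMakino1999, Sect. 2]
* M. Joldeş, *Rigorous Polynomial Approximations and Applications*, PhD thesis, ENS Lyon (2011), Section 2.2.1
  (the exponential of a small argument by the truncated series with remainder, as in `TaylorModelLog.texpCompI`).
  [cite: Joldes2011, Section 2.2.1]
-/

namespace Literature.Analysis.ValidatedNumerics

namespace PolyMP

open Literature.Analysis.ValidatedNumerics.NumericsMP
open Literature.Analysis.ValidatedNumerics.ExpPoly (Poly)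
open Literature.Analysis.ValidatedNumerics.ExpPoly

/-! ### The real shadow: rows of coefficient lists -/

/-- Evaluation of a bivariate coefficient array given by rows: `evalR2 (r :: rs) ρ σ = evalR r σ + ρ · evalR2 rs ρ σ`
(row `i` is the coefficient list, in `σ`, of `ρⁱ`). [cite: MakinoBerz2003, Definition 1] -/
noncomputable def evalR2 : List (List ℝ) → ℝ → ℝ → ℝ
  | [], _, _ => 0
  | r :: rs, ρ, σ => evalR r σ + ρ * evalR2 rs ρ σ

/-- [cite: MakinoBerz2003, Definition 1] -/
@[simp] theorem evalR2_nil (ρ σ : ℝ) : evalR2 [] ρ σ = 0 := rfl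

/-- [cite: MakinoBerz2003, Definition 1] -/
@[simp] theorem evalR2_cons (r : List ℝ) (rs : List (List ℝ)) (ρ σ : ℝ) :
    evalR2 (r :: rs) ρ σ = evalR r σ + ρ * evalR2 rs ρ σ := rfl

/-- **Collapse of the inner variable**: `evalR2 rows ρ σ` is the univariate evaluation at `ρ` of the list of row
values at `σ`. [cite: MakinoBerz2003, Definition 1] -/
theorem evalR2_eq_evalR_map : ∀ (rs : List (List ℝ)) (ρ σ : ℝ),
    evalR2 rs ρ σ = evalR (rs.map fun r => evalR r σ) ρ
  | [], _, _ => rfl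
  | r :: rs, ρ, σ => by
      simp only [evalR2_cons, List.map_cons, evalR_cons, evalR2_eq_evalR_map rs ρ σ]

/-- Row-wise sum. [cite: MakinoBerz2003, Definition 2] -/
noncomputable def addR2 : List (List ℝ) → List (List ℝ) → List (List ℝ)
  | [], q => q
  | r :: rs, [] => r :: rs
  | r :: rs, q :: qs => addR r q :: addR2 rs qs

/-- [cite: MakinoBerz2003, Definition 2] -/
theorem evalR2_addR2 : ∀ (p q : List (List ℝ)) (ρ σ : ℝ),
    evalR2 (addR2 p q) ρ σ = evalR2 p ρ σ + evalR2 q ρ σ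
  | [], q, _, _ => by simp [addR2]
  | r :: rs, [], _, _ => by simp [addR2]
  | r :: rs, q :: qs, ρ, σ => by
      simp only [addR2, evalR2_cons, evalR_addR, evalR2_addR2 rs qs ρ σ]; ring

/-- [cite: MakinoBerz2003, Definition 2] -/
theorem evalR2_map_mulR (r : List ℝ) : ∀ (qs : List (List ℝ)) (ρ σ : ℝ),
    evalR2 (qs.map (mulR r)) ρ σ = evalR r σ * evalR2 qs ρ σ
  | [], _, _ => by simp
  | q :: qs, ρ, σ => by
      simp only [List.map_cons, evalR2_cons, evalR_mulR, evalR2_map_mulR r qs ρ σ]; ring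

/-- Product of coefficient arrays: `(r + ρ·rs)·q = r·q + ρ·(rs·q)` row-wise. [cite: MakinoBerz2003, Definition 2] -/
noncomputable def mulR2 : List (List ℝ) → List (List ℝ) → List (List ℝ)
  | [], _ => []
  | r :: rs, qs => addR2 (qs.map (mulR r)) ([] :: mulR2 rs qs)

/-- [cite: MakinoBerz2003, Definition 2] -/
theorem evalR2_mulR2 : ∀ (p q : List (List ℝ)) (ρ σ : ℝ),
    evalR2 (mulR2 p q) ρ σ = evalR2 p ρ σ * evalR2 q ρ σ
  | [], q, _, _ => by simp [mulR2]
  | r :: rs, qs, ρ, σ => by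
      simp only [mulR2, evalR2_addR2, evalR2_map_mulR, evalR2_cons, evalR_nil, evalR2_mulR2 rs qs ρ σ]; ring

/-- [cite: MakinoBerz2003, Definition 2] -/
theorem evalR2_map_neg : ∀ (p : List (List ℝ)) (ρ σ : ℝ),
    evalR2 (p.map fun r => r.map Neg.neg) ρ σ = -evalR2 p ρ σ
  | [], _, _ => by simp
  | r :: rs, ρ, σ => by
      simp only [List.map_cons, evalR2_cons, evalR_map_neg, evalR2_map_neg rs ρ σ]; ring

/-- [cite: MakinoBerz2003, Definition 2] -/
theorem evalR2_map_smulR (c : ℝ) : ∀ (p : List (List ℝ)) (ρ σ : ℝ),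
    evalR2 (p.map (smulR c)) ρ σ = c * evalR2 p ρ σ
  | [], _, _ => by simp
  | r :: rs, ρ, σ => by
      simp only [List.map_cons, evalR2_cons, evalR_smulR, evalR2_map_smulR c rs ρ σ]; ring

/-- Evaluation splits at any row index: `p = (take n p) + ρⁿ · (drop n p)`. [cite: MakinoBerz2003, Definition 2] -/
theorem evalR2_take_add_drop : ∀ (n : ℕ) (p : List (List ℝ)) (ρ σ : ℝ),
    evalR2 p ρ σ = evalR2 (p.take n) ρ σ + ρ ^ n * evalR2 (p.drop n) ρ σ
  | 0, p, _, _ => by simp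
  | n + 1, [], _, _ => by simp
  | n + 1, r :: rs, ρ, σ => by
      simp only [List.take_succ_cons, List.drop_succ_cons, evalR2_cons, evalR2_take_add_drop n rs ρ σ]; ring

/-! ### Interval rows and the membership predicate -/

/-- Bivariate interval polynomials: lists of rows, row `i` an `IPoly` in `σ` (the coefficient of `ρⁱ`).
[cite: MakinoBerz2003, Definition 1] -/
abbrev IPoly2 := List IPoly

/-- Row-wise coefficient membership. [cite: MakinoBerz2003, Definition 1] -/
def PMem2 (S : ℕ) (p : List (List ℝ)) (P : IPoly2) : Prop := List.Forall₂ (PMem S) p P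

/-- [cite: MakinoBerz2003, Definition 1] -/
theorem pmem2_nil (S : ℕ) : PMem2 S [] [] := List.Forall₂.nil

/-- [cite: MakinoBerz2003, Definition 1] -/
theorem pmem2_cons {S : ℕ} {r : List ℝ} {R : IPoly} {rs : List (List ℝ)} {Rs : IPoly2} (h : PMem S r R)
    (hs : PMem2 S rs Rs) : PMem2 S (r :: rs) (R :: Rs) := List.Forall₂.cons h hs

/-- [folklore] -/
private theorem pmem2_take {S : ℕ} : ∀ (n : ℕ) {p : List (List ℝ)} {P : IPoly2}, PMem2 S p P →
    PMem2 S (p.take n) (P.take n)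
  | 0, _, _, _ => by simpa using pmem2_nil S
  | n + 1, _, _, List.Forall₂.nil => by simpa using pmem2_nil S
  | n + 1, _, _, List.Forall₂.cons hr hP => by
      simp only [List.take_succ_cons]; exact pmem2_cons hr (pmem2_take n hP)

/-- [folklore] -/
private theorem pmem2_drop {S : ℕ} : ∀ (n : ℕ) {p : List (List ℝ)} {P : IPoly2}, PMem2 S p P →
    PMem2 S (p.drop n) (P.drop n)
  | 0, _, _, h => by simpa using h
  | n + 1, _, _, List.Forall₂.nil => by simpa using pmem2_nil S
  | n + 1, _, _, List.Forall₂.cons hr hP => by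
      simp only [List.drop_succ_cons]; exact pmem2_drop n hP

/-- **Bivariate Taylor-model membership** on the box `|ρ| ≤ h, |σ| ≤ k`: `f ρ σ = Σ aᵢⱼ ρⁱ σʲ` for some array of
coefficients `aᵢⱼ ∈ Pᵢⱼ` (depending on the point; the remainder lives in the interval coefficients).
[cite: MakinoBerz2003, Definition 1] -/
def TMem2 (S : ℕ) (h k : ℚ) (f : ℝ → ℝ → ℝ) (P : IPoly2) : Prop :=
  ∀ ρ σ : ℝ, |ρ| ≤ h → |σ| ≤ k → ∃ p : List (List ℝ), PMem2 S p P ∧ f ρ σ = evalR2 p ρ σ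

/-! ### Constants and the two identity variables -/

/-- A constant. [cite: MakinoBerz2003, Algorithm 2] -/
def tconst2 (I : MI) : IPoly2 := [[I]]

/-- [cite: MakinoBerz2003, Algorithm 2] -/
theorem tmem2_const {S : ℕ} {h k : ℚ} {x : ℝ} {I : MI} (hx : MI.mem S x I) :
    TMem2 S h k (fun _ _ => x) (tconst2 I) := fun ρ σ _ _ =>
  ⟨[[x]], pmem2_cons (pmem_cons hx (pmem_nil S)) (pmem2_nil S), by simp⟩

/-- The first variable `(ρ, σ) ↦ c + ρ` (identity Taylor model, remainder zero). [cite: MakinoBerz2003, Algorithm 2] -/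
def tvarX2 (S : ℕ) (C : MI) : IPoly2 := [[C], [MI.ofInt S 1]]

/-- [cite: MakinoBerz2003, Algorithm 2] -/
theorem tmem2_varX {S : ℕ} {h k : ℚ} {c : ℝ} {C : MI} (hc : MI.mem S c C) :
    TMem2 S h k (fun ρ _ => c + ρ) (tvarX2 S C) := fun ρ σ _ _ =>
  ⟨[[c], [1]], pmem2_cons (pmem_cons hc (pmem_nil S))
    (pmem2_cons (pmem_cons (by simpa using MI.mem_ofInt S 1) (pmem_nil S)) (pmem2_nil S)), by simp⟩

/-- The second variable `(ρ, σ) ↦ c + σ`. [cite: MakinoBerz2003, Algorithm 2] -/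
def tvarY2 (S : ℕ) (C : MI) : IPoly2 := [[C, MI.ofInt S 1]]

/-- [cite: MakinoBerz2003, Algorithm 2] -/
theorem tmem2_varY {S : ℕ} {h k : ℚ} {c : ℝ} {C : MI} (hc : MI.mem S c C) :
    TMem2 S h k (fun _ σ => c + σ) (tvarY2 S C) := fun ρ σ _ _ =>
  ⟨[[c, 1]], pmem2_cons (pmem_cons hc (pmem_cons (by simpa using MI.mem_ofInt S 1) (pmem_nil S)))
    (pmem2_nil S), by simp⟩

/-! ### Linear operations -/

/-- Row-wise sum. [cite: MakinoBerz2003, Definition 2] -/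
def tadd2 : IPoly2 → IPoly2 → IPoly2
  | [], Q => Q
  | R :: Rs, [] => R :: Rs
  | R :: Rs, Q :: Qs => addI R Q :: tadd2 Rs Qs

/-- [cite: MakinoBerz2003, Definition 2] -/
theorem pmem2_add {S : ℕ} : ∀ {p q : List (List ℝ)} {P Q : IPoly2}, PMem2 S p P → PMem2 S q Q →
    PMem2 S (addR2 p q) (tadd2 P Q)
  | _, _, _, _, List.Forall₂.nil, hQ => by simpa [addR2, tadd2] using hQ
  | _, _, _, _, List.Forall₂.cons hr hP, List.Forall₂.nil => by
      simp only [addR2, tadd2]; exact List.Forall₂.cons hr hP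
  | _, _, _, _, List.Forall₂.cons hr hP, List.Forall₂.cons hq hQ => by
      simp only [addR2, tadd2]; exact List.Forall₂.cons (pmem_addI hr hq) (pmem2_add hP hQ)

/-- **Sum of bivariate Taylor models.** [cite: MakinoBerz2003, Definition 2] -/
theorem tmem2_add {S : ℕ} {h k : ℚ} {f g : ℝ → ℝ → ℝ} {P Q : IPoly2} (hf : TMem2 S h k f P)
    (hg : TMem2 S h k g Q) : TMem2 S h k (fun ρ σ => f ρ σ + g ρ σ) (tadd2 P Q) := fun ρ σ hρ hσ => by
  obtain ⟨p, hp, ef⟩ := hf ρ σ hρ hσ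
  obtain ⟨q, hq, eg⟩ := hg ρ σ hρ hσ
  exact ⟨addR2 p q, pmem2_add hp hq, by simp only [evalR2_addR2, ef, eg]⟩

/-- Negation. [cite: MakinoBerz2003, Definition 2] -/
def tneg2 (P : IPoly2) : IPoly2 := P.map tnegI

/-- [folklore] -/
private theorem pmem2_neg {S : ℕ} : ∀ {p : List (List ℝ)} {P : IPoly2}, PMem2 S p P →
    PMem2 S (p.map fun r => r.map Neg.neg) (tneg2 P)
  | _, _, List.Forall₂.nil => by simpa [tneg2] using pmem2_nil S
  | _, _, List.Forall₂.cons hr hP => by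
      simp only [List.map_cons, tneg2]; exact List.Forall₂.cons (pmem_neg hr) (pmem2_neg hP)

/-- **Negation of a bivariate Taylor model.** [cite: MakinoBerz2003, Definition 2] -/
theorem tmem2_neg {S : ℕ} {h k : ℚ} {f : ℝ → ℝ → ℝ} {P : IPoly2} (hf : TMem2 S h k f P) :
    TMem2 S h k (fun ρ σ => -f ρ σ) (tneg2 P) := fun ρ σ hρ hσ => by
  obtain ⟨p, hp, ef⟩ := hf ρ σ hρ hσ
  exact ⟨p.map fun r => r.map Neg.neg, pmem2_neg hp, by simp only [evalR2_map_neg, ef]⟩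

/-- Difference. [cite: MakinoBerz2003, Definition 2] -/
def tsub2 (P Q : IPoly2) : IPoly2 := tadd2 P (tneg2 Q)

/-- [cite: MakinoBerz2003, Definition 2] -/
theorem tmem2_sub {S : ℕ} {h k : ℚ} {f g : ℝ → ℝ → ℝ} {P Q : IPoly2} (hf : TMem2 S h k f P)
    (hg : TMem2 S h k g Q) : TMem2 S h k (fun ρ σ => f ρ σ - g ρ σ) (tsub2 P Q) := by
  have := tmem2_add hf (tmem2_neg hg)
  simpa [sub_eq_add_neg, tsub2] using this

/-- Product with an interval constant (row-wise `smulI`). [cite: MakinoBerz2003, Definition 2] -/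
def tsmulI2 (S : ℕ) (C : MI) (P : IPoly2) : IPoly2 := P.map (smulI S C)

/-- [folklore] -/
private theorem pmem2_smulI {S : ℕ} (hS : 0 < S) {c : ℝ} {C : MI} (hc : MI.mem S c C) :
    ∀ {p : List (List ℝ)} {P : IPoly2}, PMem2 S p P → PMem2 S (p.map (smulR c)) (tsmulI2 S C P)
  | _, _, List.Forall₂.nil => by simpa [tsmulI2] using pmem2_nil S
  | _, _, List.Forall₂.cons hr hP => by
      simp only [List.map_cons, tsmulI2]; exact List.Forall₂.cons (pmem_smulI hS hc hr) (pmem2_smulI hS hc hP)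

/-- **Interval multiple of a bivariate Taylor model.** [cite: MakinoBerz2003, Definition 2] -/
theorem tmem2_smulI {S : ℕ} (hS : 0 < S) {h k : ℚ} {c : ℝ} {C : MI} (hc : MI.mem S c C) {f : ℝ → ℝ → ℝ}
    {P : IPoly2} (hf : TMem2 S h k f P) : TMem2 S h k (fun ρ σ => c * f ρ σ) (tsmulI2 S C P) :=
  fun ρ σ hρ hσ => by
  obtain ⟨p, hp, ef⟩ := hf ρ σ hρ hσ
  exact ⟨p.map (smulR c), pmem2_smulI hS hc hp, by simp only [evalR2_map_smulR, ef]⟩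

/-! ### The collapse onto the outer variable and the range bounds -/

/-- **Collapse**: replace every row by the scaled range interval `[tlowerI, tupperI]` of that row on `|σ| ≤ k`;
the result is a univariate interval polynomial in `ρ`. [cite: MakinoBerz2003, Definition 2] -/
def tcollapse (S : ℕ) (k : ℚ) (P : IPoly2) : IPoly := P.map fun R => (⟨tlowerI S k R, tupperI S k R⟩ : MI)

/-- [folklore] -/
private theorem pmem_collapse {S : ℕ} {k : ℚ} (k0 : 0 ≤ k) {σ : ℝ} (hσ : |σ| ≤ k) :
    ∀ {p : List (List ℝ)} {P : IPoly2}, PMem2 S p P → PMem S (p.map fun r => evalR r σ) (tcollapse S k P)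
  | _, _, List.Forall₂.nil => by simpa [tcollapse] using pmem_nil S
  | _, _, List.Forall₂.cons (a := r) (b := R) hr hP => by
      simp only [List.map_cons, tcollapse]
      have hT : TMem S k (fun σ' => evalR r σ') R := fun σ' _ => ⟨r, hr, rfl⟩
      exact pmem_cons ⟨tlowerI_le k0 hT hσ, le_tupperI k0 hT hσ⟩ (pmem_collapse k0 hσ hP)

/-- **Soundness of the collapse**: every `σ`-section of a bivariate Taylor model is a univariate Taylor model with
coefficients in the collapsed rows (so all univariate range bounds apply). [cite: MakinoBerz2003, Definition 2] -/
theorem tmem_collapse {S : ℕ} {h k : ℚ} (k0 : 0 ≤ k) {f : ℝ → ℝ → ℝ} {P : IPoly2} (hf : TMem2 S h k f P)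
    {σ : ℝ} (hσ : |σ| ≤ k) : TMem S h (fun ρ => f ρ σ) (tcollapse S k P) := fun ρ hρ => by
  obtain ⟨p, hp, ef⟩ := hf ρ σ hρ hσ
  exact ⟨p.map fun r => evalR r σ, pmem_collapse k0 hσ hp, by
    show f ρ σ = _
    rw [ef, evalR2_eq_evalR_map]⟩

/-- Scaled upper bound of `f` on the box (`B(P)` by naive interval evaluation). [cite: MakinoBerz2003, Definition 2] -/
def tupper2 (S : ℕ) (h k : ℚ) (P : IPoly2) : ℤ := tupperI S h (tcollapse S k P)

/-- Scaled lower bound of `f` on the box. [cite: MakinoBerz2003, Definition 2] -/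
def tlower2 (S : ℕ) (h k : ℚ) (P : IPoly2) : ℤ := tlowerI S h (tcollapse S k P)

/-- Scaled bound of `|f|` on the box. [cite: MakinoBerz2003, Definition 2] -/
def tabs2 (S : ℕ) (h k : ℚ) (P : IPoly2) : ℤ := tabsI S h (tcollapse S k P)

/-- [cite: MakinoBerz2003, Definition 2] -/
theorem le_tupper2 {S : ℕ} {h k : ℚ} (h0 : 0 ≤ h) (k0 : 0 ≤ k) {f : ℝ → ℝ → ℝ} {P : IPoly2}
    (hf : TMem2 S h k f P) {ρ σ : ℝ} (hρ : |ρ| ≤ h) (hσ : |σ| ≤ k) : f ρ σ * S ≤ (tupper2 S h k P : ℝ) :=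
  le_tupperI h0 (tmem_collapse k0 hf hσ) hρ

/-- [cite: MakinoBerz2003, Definition 2] -/
theorem tlower2_le {S : ℕ} {h k : ℚ} (h0 : 0 ≤ h) (k0 : 0 ≤ k) {f : ℝ → ℝ → ℝ} {P : IPoly2}
    (hf : TMem2 S h k f P) {ρ σ : ℝ} (hρ : |ρ| ≤ h) (hσ : |σ| ≤ k) : (tlower2 S h k P : ℝ) ≤ f ρ σ * S :=
  tlowerI_le h0 (tmem_collapse k0 hf hσ) hρ

/-- [cite: MakinoBerz2003, Definition 2] -/
theorem abs_le_tabs2 {S : ℕ} {h k : ℚ} (h0 : 0 ≤ h) (k0 : 0 ≤ k) {f : ℝ → ℝ → ℝ} {P : IPoly2}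
    (hf : TMem2 S h k f P) {ρ σ : ℝ} (hρ : |ρ| ≤ h) (hσ : |σ| ≤ k) : |f ρ σ| * S ≤ (tabs2 S h k P : ℝ) :=
  abs_le_tabsI h0 (tmem_collapse k0 hf hσ) hρ

/-! ### Truncation and the product -/

/-- Widen the constant coefficient (row `0`, column `0`). [cite: MakinoBerz2003, Definition 2] -/
def widen00 (P : IPoly2) (e : ℤ) : IPoly2 :=
  match P with
  | [] => [[⟨-e, e⟩]]
  | R :: Rs => widen0 R e :: Rs

/-- Folding a perturbation of the value into the constant coefficient. [cite: MakinoBerz2003, Definition 2] -/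
theorem exists_widen00 {S : ℕ} {p : List (List ℝ)} {P : IPoly2} (hp : PMem2 S p P) {δ : ℝ} {e : ℤ}
    (hδ : |δ| * S ≤ e) (ρ σ : ℝ) :
    ∃ q : List (List ℝ), PMem2 S q (widen00 P e) ∧ evalR2 q ρ σ = evalR2 p ρ σ + δ := by
  match p, P, hp with
  | [], [], _ =>
    obtain ⟨bs, hbs, ebs⟩ := exists_widen0 (pmem_nil S) hδ σ
    exact ⟨[bs], pmem2_cons hbs (pmem2_nil S), by simp [ebs]⟩
  | r :: rs, R :: Rs, List.Forall₂.cons hr hRs =>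
    obtain ⟨bs, hbs, ebs⟩ := exists_widen0 hr hδ σ
    exact ⟨bs :: rs, pmem2_cons hbs hRs, by simp [ebs]; ring⟩

/-- Row-wise `σ`-truncation with decreasing degree: row `0` to degree `D`, row `1` to degree `D − 1`, … (total
degree `D`). [cite: MakinoBerz2003, Definition 2] -/
def ttruncRows (S : ℕ) (k : ℚ) : ℕ → IPoly2 → IPoly2
  | _, [] => []
  | D, R :: Rs => ttruncI S k D R :: ttruncRows S k (D - 1) Rs

/-- [folklore] -/
private theorem exists_ttruncRows {S : ℕ} {k : ℚ} (k0 : 0 ≤ k) {σ : ℝ} (hσ : |σ| ≤ k) (ρ : ℝ) :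
    ∀ (D : ℕ) {p : List (List ℝ)} {P : IPoly2}, PMem2 S p P →
      ∃ q : List (List ℝ), PMem2 S q (ttruncRows S k D P) ∧ evalR2 q ρ σ = evalR2 p ρ σ
  | D, _, _, List.Forall₂.nil => ⟨[], pmem2_nil S, rfl⟩
  | D, _, _, List.Forall₂.cons (a := r) (b := R) hr hP => by
      have hT : TMem S k (fun σ' => evalR r σ') R := fun σ' _ => ⟨r, hr, rfl⟩
      obtain ⟨bs, hbs, ebs⟩ := tmem_trunc k0 D hT σ hσ
      obtain ⟨q, hq, eq⟩ := exists_ttruncRows k0 hσ ρ (D - 1) hP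
      exact ⟨bs :: q, pmem2_cons hbs hq, by simp only [evalR2_cons, eq, ← ebs]⟩

/-- **Truncation to total degree `D`**: rows `0 … D` are kept (row `i` cut to `σ`-degree `D − i`), the rows beyond
`D` are bounded on the box (`tailBoundI` of the collapsed rows) and folded into the constant coefficient.
[cite: MakinoBerz2003, Definition 2] -/
def ttrunc2 (S : ℕ) (h k : ℚ) (D : ℕ) (P : IPoly2) : IPoly2 :=
  widen00 (ttruncRows S k D (P.take (D + 1))) (tailBoundI S h (D + 1) (tcollapse S k (P.drop (D + 1))))

/-- **Soundness of the truncation.** [cite: MakinoBerz2003, Definition 2] -/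
theorem tmem2_trunc {S : ℕ} {h k : ℚ} (h0 : 0 ≤ h) (k0 : 0 ≤ k) (D : ℕ) {f : ℝ → ℝ → ℝ} {P : IPoly2}
    (hf : TMem2 S h k f P) : TMem2 S h k f (ttrunc2 S h k D P) := fun ρ σ hρ hσ => by
  obtain ⟨p, hp, ef⟩ := hf ρ σ hρ hσ
  have hsplit := evalR2_take_add_drop (D + 1) p ρ σ
  have htail := tail_le_tailBoundI h0 (D + 1) (pmem_collapse k0 hσ (pmem2_drop (D + 1) hp)) hρ
  obtain ⟨q, hq, eq⟩ := exists_ttruncRows k0 hσ ρ D (pmem2_take (D + 1) hp)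
  obtain ⟨q', hq', eq'⟩ := exists_widen00 hq htail ρ σ
  refine ⟨q', hq', ?_⟩
  rw [eq', eq, ef, hsplit, evalR2_eq_evalR_map (p.drop (D + 1))]

/-- The full row-wise product (degree doubling). [cite: MakinoBerz2003, Definition 2] -/
def mul2 (S : ℕ) : IPoly2 → IPoly2 → IPoly2
  | [], _ => []
  | R :: Rs, Qs => tadd2 (Qs.map (mulI S R)) ([] :: mul2 S Rs Qs)

/-- [folklore] -/
private theorem pmem2_map_mulI {S : ℕ} (hS : 0 < S) {r : List ℝ} {R : IPoly} (hr : PMem S r R) :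
    ∀ {q : List (List ℝ)} {Q : IPoly2}, PMem2 S q Q → PMem2 S (q.map (mulR r)) (Q.map (mulI S R))
  | _, _, List.Forall₂.nil => by simpa using pmem2_nil S
  | _, _, List.Forall₂.cons hq hQ => by
      simp only [List.map_cons]; exact pmem2_cons (pmem_mulI hS hr hq) (pmem2_map_mulI hS hr hQ)

/-- [cite: MakinoBerz2003, Definition 2] -/
theorem pmem2_mul2 {S : ℕ} (hS : 0 < S) : ∀ {p q : List (List ℝ)} {P Q : IPoly2}, PMem2 S p P → PMem2 S q Q →
    PMem2 S (mulR2 p q) (mul2 S P Q)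
  | _, _, _, _, List.Forall₂.nil, _ => by simpa [mulR2, mul2] using pmem2_nil S
  | _, _, _, _, List.Forall₂.cons hr hP, hQ => by
      simp only [mulR2, mul2]
      exact pmem2_add (pmem2_map_mulI hS hr hQ) (pmem2_cons (pmem_nil S) (pmem2_mul2 hS hP hQ))

/-- **The truncated product** of bivariate Taylor models (total degree `D`). [cite: MakinoBerz2003, Definition 2] -/
def tmul2 (S : ℕ) (h k : ℚ) (D : ℕ) (P Q : IPoly2) : IPoly2 := ttrunc2 S h k D (mul2 S P Q)

/-- **Soundness of the truncated product.** [cite: MakinoBerz2003, Definition 2] -/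
theorem tmem2_mul {S : ℕ} (hS : 0 < S) {h k : ℚ} (h0 : 0 ≤ h) (k0 : 0 ≤ k) (D : ℕ) {f g : ℝ → ℝ → ℝ}
    {P Q : IPoly2} (hf : TMem2 S h k f P) (hg : TMem2 S h k g Q) :
    TMem2 S h k (fun ρ σ => f ρ σ * g ρ σ) (tmul2 S h k D P Q) := by
  refine tmem2_trunc h0 k0 D fun ρ σ hρ hσ => ?_
  obtain ⟨p, hp, ef⟩ := hf ρ σ hρ hσ
  obtain ⟨q, hq, eg⟩ := hg ρ σ hρ hσ
  exact ⟨mulR2 p q, pmem2_mul2 hS hp hq, by rw [evalR2_mulR2, ef, eg]⟩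

/-! ### Rational polynomials of a bivariate Taylor model and the exponential -/

/-- `p(u(ρ, σ))` in bivariate Taylor-model arithmetic, `p` a rational coefficient list (Horner).
[cite: MakinoBerz2003, Definition 3] -/
def thorner2 (S : ℕ) (h k : ℚ) (D : ℕ) : List ℚ → IPoly2 → IPoly2
  | [], _ => tconst2 (MI.ofInt S 0)
  | c :: cs, U => tadd2 (tconst2 (ofRat S c)) (tmul2 S h k D U (thorner2 S h k D cs U))

/-- **Soundness of `thorner2`.** [cite: MakinoBerz2003, Definition 3] -/
theorem tmem2_horner {S : ℕ} (hS : 0 < S) {h k : ℚ} (h0 : 0 ≤ h) (k0 : 0 ≤ k) (D : ℕ) {u : ℝ → ℝ → ℝ}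
    {U : IPoly2} (hu : TMem2 S h k u U) :
    ∀ cs : List ℚ, TMem2 S h k (fun ρ σ => Poly.eval cs (u ρ σ)) (thorner2 S h k D cs U)
  | [] => by
      simpa [thorner2] using (tmem2_const (h := h) (k := k) (MI.mem_ofInt S 0))
  | c :: cs => by
      have ih := tmem2_horner hS h0 k0 D hu cs
      have := tmem2_add (tmem2_const (h := h) (k := k) (mem_ofRat S c)) (tmem2_mul hS h0 k0 D hu ih)
      simpa [thorner2, Poly.eval] using this

/-- The exponential series with remainder (`Real.exp_bound`): for `|u| ≤ 1` and `0 < K`,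
`|e^{u} − Σ_{k<K} u^k/k!| ≤ |u|^K (K+1)/(K!·K)`. [folklore] -/
private theorem abs_exp_sub_eval_expSer_le {u : ℝ} (hu : |u| ≤ 1) {K : ℕ} (hK : 0 < K) :
    |Real.exp u - Poly.eval (expSerCoeffs K) u| ≤ |u| ^ K * ((K + 1 : ℝ) / ((K.factorial : ℝ) * K)) := by
  have h := Real.exp_bound hu hK
  have hs : Poly.eval (expSerCoeffs K) u = ∑ m ∈ Finset.range K, u ^ m / m.factorial := by
    rw [expSerCoeffs, poly_eval_map_range]
    refine Finset.sum_congr rfl fun k _ => ?_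
    push_cast
    ring
  rw [hs]
  convert h using 2
  push_cast
  ring

/-- The bivariate Taylor model of `e^{u}` for a small `u` (`|u| ≤ 1` certified by `tabs2 ≤ S`): Horner on the
exponential series plus the remainder folded into the constant coefficient. [cite: MakinoBerz2003, Definition 3] -/
def texpComp2 (S : ℕ) (h k : ℚ) (D K : ℕ) (U : IPoly2) : IPoly2 :=
  widen00 (thorner2 S h k D (expSerCoeffs K) U) (texpCompRem S (tabs2 S h k U) K)

/-- **Soundness of `texpComp2`** (`0 < K`, `tabs2 S h k U ≤ S`): the series part of (2.2) in Taylor-model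
arithmetic, the Lagrange remainder (2.3)–(2.4) bounded from the range bound of `u`.
[cite: MakinoBerz2003, Definition 3] [cite: Joldes2011, Section 2.2.1] -/
theorem tmem2_expComp {S : ℕ} (hS : 0 < S) {h k : ℚ} (h0 : 0 ≤ h) (k0 : 0 ≤ k) (D : ℕ) {K : ℕ} (hK : 0 < K)
    {u : ℝ → ℝ → ℝ} {U : IPoly2} (hu : TMem2 S h k u U) (hB : tabs2 S h k U ≤ S) :
    TMem2 S h k (fun ρ σ => Real.exp (u ρ σ)) (texpComp2 S h k D K U) := by
  intro ρ σ hρ hσ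
  obtain ⟨p, hp, hev⟩ := tmem2_horner hS h0 k0 D hu (expSerCoeffs K) ρ σ hρ hσ
  have hSr : (0 : ℝ) < S := by exact_mod_cast hS
  have habs := abs_le_tabs2 h0 k0 hu hρ hσ
  have huB : |u ρ σ| ≤ ((tabs2 S h k U : ℤ) : ℝ) / S := by rw [le_div_iff₀ hSr]; exact habs
  have hu1 : |u ρ σ| ≤ 1 := by
    have : ((tabs2 S h k U : ℤ) : ℝ) ≤ S := by exact_mod_cast hB
    exact huB.trans ((div_le_one hSr).2 this)
  have hδle : |Real.exp (u ρ σ) - Poly.eval (expSerCoeffs K) (u ρ σ)| * S ≤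
      (texpCompRem S (tabs2 S h k U) K : ℝ) := by
    have h1 := abs_exp_sub_eval_expSer_le hu1 hK
    have h2 : |u ρ σ| ^ K ≤ (((tabs2 S h k U : ℤ) : ℝ) / S) ^ K := pow_le_pow_left₀ (abs_nonneg _) huB K
    have hc : (0 : ℝ) ≤ (K + 1 : ℝ) / ((K.factorial : ℝ) * K) := by positivity
    have h3 := h1.trans (mul_le_mul_of_nonneg_right h2 hc)
    have h4 : ((S : ℚ) * (((((tabs2 S h k U : ℤ) : ℚ) / S) ^ K) * ((K + 1 : ℚ) / ((K.factorial : ℚ) * K))) : ℝ) ≤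
        (texpCompRem S (tabs2 S h k U) K : ℝ) := by
      unfold texpCompRem; exact_mod_cast Int.le_ceil _
    refine le_trans ?_ h4
    push_cast
    rw [mul_comm ((S : ℕ) : ℝ)]
    exact mul_le_mul_of_nonneg_right h3 hSr.le
  obtain ⟨q, hq, hev2⟩ := exists_widen00 hp hδle ρ σ
  exact ⟨q, hq, by rw [hev2, ← hev]; ring⟩

/-- The rational midpoint of the constant coefficient (`0` for a model without one). [cite: MakinoBerz2003, Definition 3] -/
def mid00 (S : ℕ) : IPoly2 → ℚ
  | (I :: _) :: _ => ((I.lo + I.hi : ℤ) : ℚ) / (2 * (S : ℚ))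
  | _ => 0

/-- **The bivariate Taylor model of `exp ∘ g`** with its acceptance flag: `c = mid00 S G`, `e^{g} = e^{c} · e^{g − c}`
with `e^{c} ∈ MI.expPt S Ke ke (ofRat S c)`, `|g − c|·S ≤ tabs2 ≤ S`, `0 < K` — the factorisation (2.2) of op. cit.
[cite: MakinoBerz2003, Definition 3] -/
def texp2TM (S : ℕ) (h k : ℚ) (D K Ke ke : ℕ) (G : IPoly2) : IPoly2 × Bool :=
  let c := mid00 S G
  let U := tsub2 G (tconst2 (ofRat S c))
  match MI.expPt S Ke ke (ofRat S c) with
  | none => ([], false)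
  | some E => (tsmulI2 S E (texpComp2 S h k D K U), decide (0 < K) && decide (tabs2 S h k U ≤ S))

/-- **Soundness of `texp2TM`**: if `G` encloses `g` on the box and the flag is raised, the returned model encloses
`(ρ, σ) ↦ e^{g(ρ, σ)}`. [cite: MakinoBerz2003, Definition 3] -/
theorem tmem2_exp_of_texp2TM {S : ℕ} (hS : 0 < S) {h k : ℚ} (h0 : 0 ≤ h) (k0 : 0 ≤ k) {D K Ke ke : ℕ}
    {g : ℝ → ℝ → ℝ} {G : IPoly2} (hg : TMem2 S h k g G) (hok : (texp2TM S h k D K Ke ke G).2 = true) :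
    TMem2 S h k (fun ρ σ => Real.exp (g ρ σ)) (texp2TM S h k D K Ke ke G).1 := by
  unfold texp2TM at hok ⊢
  rcases hE : MI.expPt S Ke ke (ofRat S (mid00 S G)) with _ | E
  · simp only [hE] at hok; exact absurd hok Bool.false_ne_true
  · simp only [hE, Bool.and_eq_true, decide_eq_true_eq] at hok ⊢
    obtain ⟨hK, hB⟩ := hok
    have hexpc := MI.mem_expPt hS hE (mem_ofRat S (mid00 S G))
    have hU : TMem2 S h k (fun ρ σ => g ρ σ - ((mid00 S G : ℚ) : ℝ)) (tsub2 G (tconst2 (ofRat S (mid00 S G)))) :=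
      tmem2_sub hg (tmem2_const (mem_ofRat S _))
    have hprod := tmem2_smulI hS hexpc (tmem2_expComp hS h0 k0 D hK hU hB)
    intro ρ σ hρ hσ
    obtain ⟨p, hp, hev⟩ := hprod ρ σ hρ hσ
    refine ⟨p, hp, ?_⟩
    rw [← hev]
    show Real.exp (g ρ σ) = Real.exp ((mid00 S G : ℚ) : ℝ) * Real.exp (g ρ σ - ((mid00 S G : ℚ) : ℝ))
    rw [← Real.exp_add]
    congr 1
    ring

end PolyMP

end Literature.Analysis.ValidatedNumerics
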